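import Summits.Langlands.Langlands.Theorems.QuadraticWindowHostInducedRepPackageCompose
import Summits.Langlands.Langlands.Theorems.QuadraticWindowHostInducedRepPackageFamilyCont
import Summits.Langlands.Langlands.Theorems.QuadraticWindowHostInducedRepMemberSignCont

/-!
# The member statement and the reshaped `stub_package` in the continuation-form currency —
# `pkg_member_of_split_cont`, `stub_package_cont` (line `one-transparent-pane`, crux
# `Summit.Langlands.Langlands.Theses.QuadraticWindow.HostInducedRep`, stmt-Langlands-10902; wave 4)

LOG (wave-4 worker C, 2026-08-16): `_cont` variants of the landed `pkg_member_of_split` and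
`stub_package''` (`QuadraticWindowHostInducedRepPackageCompose.lean`, p115436).  The only change is the
CURRENCY of the Asai sign: the three sign hypotheses `hex` (existence of Asai signs), `hpin` (Mok's
archimedean sign pin) and `hpane` (the pane law, conclusion of `stub_paneLaw_cont`) are stated with
`HasAsaiSignCont` (continued partial Asai `L`-function, `Literature/NumberTheory/Automorphic/AsaiSignCont.lean`)
instead of the raw Euler-product rendering `HasAsaiSign`, the member conclusion is `MemberPkgCont`
(`QuadraticWindowHostInducedRepPaneDefsCont.lean`), and the sign conjunct of the family output is
`HasAsaiSignCont … 1`.  The proofs are the landed ones with `stub_memberSign` ↦ `stub_memberSign_cont`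
(`QuadraticWindowHostInducedRepMemberSignCont.lean`) and `stub_package_of_member` ↦
`stub_package_of_member_cont` (`QuadraticWindowHostInducedRepPackageFamilyCont.lean`); the five sign-free
member sub-stubs `stub_memberTower/Satake/Arch/PaneArch/Parity` are reused unchanged.  Sorry-free.
Registered (stub registry of the item): `pkg_member_of_split_cont` (textual `∀`-form; `stub_package_cont`
exceeds the registry's 3900-character cut and is consumed by name).

Statement (`pkg_member_of_split_cont`).  Facts in front (`hAI` automorphic induction, `hBC` base change in
prime degree with a ramified unramified-for-`π` place, `hext` unitary extension of Hecke characters with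
prescribed unramified places, `harch` Arthur–Clozel at infinity, `hHen` Henniart's infinity types of
automorphic inductions, `hinf` existence of infinity types, `hCFT` archimedean Artin reciprocity for
characters, `hex`, `hpin`, `hpane` in continuation form), then the crux data with `Hyps`, `F` not totally
real, and a CM quadratic `K/F₀` ramified at a guarded place with no `F₀`-embedding of `F`; conclusion
`MemberPkgCont F₀ π ι eψ K`.  Statement (`stub_package_cont`): the same facts and crux data; conclusion the
`GoodPrime` family output consumed by `stub_patch` through `stub_galoisOverK_cont`.

Proof.  `pkg_member_of_split_cont`: the involution `cK` of `K/F₀` (`exists_algEquiv_ne_one`), the pane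
tower (`stub_memberTower`), the Artin avatars `χe, ω` (`artinReciprocity_character_holds`) and the
restriction `ω₀` (`heckeCharacter_exists_restrict`), the parity output (`stub_memberParity`), and for every
admissible `μ` the objects of `stub_memberSatake` with the infinity type of `stub_memberArch` and the pane
parameter of `stub_memberPaneArch`; `stub_memberSign_cont` concludes.  `stub_package_cont` =
`stub_package_of_member_cont` ∘ `pkg_member_of_split_cont`.

References: J. Arthur, L. Clozel, Ann. of Math. Stud. 120 (1989) [ArthurClozel1989]; C. P. Mok, Mem. AMS
235 (2015), Thm. 2.5.4 [Mok2014]; C. M. Sorensen, LMS LNS 457 (2020), §1 [Sorensen2020].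
-/

open scoped BigOperators Polynomial Classical
open Filter Set Polynomial IsDedekindDomain NumberField
open Literature.NumberTheory.Automorphic Literature.NumberTheory.GaloisRepresentations
open Literature.NumberTheory.GaloisRepresentations.QuadraticFamily
open Literature.NumberTheory.Automorphic.PatchingFamily
open Summit.Langlands.Langlands.Theorems.HostInducedRep.GrsExplicitDescent

-- `Summit.Langlands.Langlands.…` (summit = sub-problem name, D-0017 layout) trips `dupNamespace`.
set_option linter.dupNamespace false

noncomputable section

namespace Summit.Langlands.Langlands.Theorems.HostInducedRep.OneTransparentPane

/-! ## The checked composition, continuation-form currency -/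

section Compose

/-- **`pkg_member` in continuation form from the six sub-stubs (CHECKED COMPOSITION).**  Facts in front
(`hAI`, `hBC`, `hext`, `harch`, `hHen`, `hinf`, `hCFT`, and `hex`, `hpin`, `hpane` with `HasAsaiSignCont`),
then the crux data with `Hyps`, `F` not totally real, and the CM quadratic `K/F₀` ramified at a guarded
place with no `F₀`-embedding of `F`; conclusion `MemberPkgCont`.  Threading: `cK`
(`exists_algEquiv_ne_one`), the tower (`stub_memberTower`), the Artin avatars `χe, ω`
(`artinReciprocity_character_holds`) and the restriction `ω₀` (`heckeCharacter_exists_restrict`), the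
parity output (`stub_memberParity`), and for every admissible `μ` the objects of `stub_memberSatake` with
the infinity type of `stub_memberArch` and the pane parameter of `stub_memberPaneArch`;
`stub_memberSign_cont` concludes.  Verbatim the landed `pkg_member_of_split` up to the currency.
[cite: Mok2014, Thm. 2.5.4 (a)] [cite: ArthurClozel1989, Ch. 3, Thm. 4.2 and Thm. 5.1] -/
theorem pkg_member_of_split_cont : ∀ (hAI : automorphicInduction_cyclic_cuspidal_unramified)
    (hBC : ∀ (n : ℕ) (F E : Type) [Field F] [NumberField F] [Field E] [NumberField E] [Algebra F E]
      [IsGalois F E], (Module.finrank F E).Prime →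
      ∀ (hF : isCompact_glFiniteIntegralLevel n F) (π : CuspidalAutomorphicRepData n F hF),
        (∃ v : HeightOneSpectrum (𝓞 F), ¬ Algebra.IsUnramifiedIn (𝓞 E) v.asIdeal ∧ π.1.IsUnramifiedAt v) →
        ∀ (hE : isCompact_glFiniteIntegralLevel n E),
          ∃ P : CuspidalAutomorphicRepData n E hE, IsUnramifiedBaseChangeLift π.1 P.1)
    (hext : ∀ (F₀ K : Type) [Field F₀] [NumberField F₀] [Field K] [NumberField K] [Algebra F₀ K]
      (c : K ≃ₐ[F₀] K), Module.finrank F₀ K = 2 → c ≠ 1 →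
      ∀ (χ₀ : HeckeCharacter F₀), χ₀.IsUnitary →
      ∀ (U : Set (HeightOneSpectrum (𝓞 K))),
        (∀ u ∈ U, c • u ∈ U → χ₀.IsUnramifiedAt (u.under (𝓞 F₀))) →
        ∃ χ : HeckeCharacter K, χ.IsUnitary ∧
          (∀ x, χ (AdeleRing.ideleBaseChange F₀ K x) = χ₀ x) ∧ ∀ u ∈ U, χ.IsUnramifiedAt u)
    (harch : ArthurClozel1989_strongLifting_archimedean)
    (hHen : Henniart2012_infinityType_of_automorphicInduction)
    (hinf : ∀ (N : ℕ) (K : Type) [Field K] [NumberField K] (hK : isCompact_glFiniteIntegralLevel N K)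
      (P : AutomorphicRepData (AutomorphyDatum.gl N K hK)), P.exists_hasInfinityType)
    (hCFT : artinReciprocity_character_archimedean)
    (hex : ∀ (F E : Type) [Field F] [NumberField F] [Field E] [NumberField E] [Algebra F E] (c : E ≃ₐ[F] E), Module.finrank F E = 2 → c ≠ 1 → ∀ (N : ℕ) (hcpt : isCompact_glFiniteIntegralLevel N E) (P : CuspidalAutomorphicRepData N E hcpt), 0 < N → P.1.IsConjSelfDualAE c → ∃ κ : ℤˣ, P.1.HasAsaiSignCont c κ)
    (hpin : ∀ (F E : Type) [Field F] [NumberField F] [Field E] [NumberField E] [Algebra F E] (c : E ≃ₐ[F] E), Module.finrank F E = 2 → c ≠ 1 → ∀ (N : ℕ) (hcpt : isCompact_glFiniteIntegralLevel N E) (P : CuspidalAutomorphicRepData N E hcpt) (κ : ℤˣ) (χ : (E →+* ℂ) → Multiset ℂ) (σ : E →+* ℂ) (r : ℝ), 0 < N → P.1.IsConjSelfDualAE c → P.1.HasAsaiSignCont c κ → P.1.HasArchParameter χ → NumberField.ComplexEmbedding.IsConj σ c → (χ σ).Nodup → (∀ a ∈ χ σ, ∃ m : ℤ, a = (m : ℂ)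 + (r : ℂ)) → ∀ a ∈ χ σ, ∃ m : ℤ, a = (m : ℂ) + ((N : ℂ) - 1) / 2 + (1 - ((κ : ℤ) : ℂ)) / 4)
    (hpane : ∀ (F₀ K F' L : Type) [Field F₀] [NumberField F₀] [Field K] [NumberField K] [Field F'] [NumberField F'] [Field L] [NumberField L] [Algebra F₀ K] [Algebra K L] [Algebra F' L] (cK : K ≃ₐ[F₀] K) (s : L ≃ₐ[F'] L), Module.finrank F₀ K = 2 → Module.finrank K L = 2 → Module.finrank F' L = 2 → cK ≠ 1 → s ≠ 1 → (∀ x : K, s (algebraMap K L x) = algebraMap K L (cK x)) → ∀ (n : ℕ) (hL : isCompact_glFiniteIntegralLevel n L) (hK : isCompact_glFiniteIntegralLevel (2 * n) K) (P : CuspidalAutomorphicRepData n L hL) (Q : CuspidalAutomorphicRepData (2 * n) K hK) (χ : (L →+* ℂ) → Multiset ℂ) (σ : L →+* ℂ), 0 < n → IsAutomorphicInductionAlong P.1 Q.1 → P.1.IsConjSelfDualAE s → Q.1.IsConjSelfDualAE cK → P.1.HasArchParameter χ → NumberField.ComplexEmbedding.IsConj σ s → (χ σ).Nodup → Multiset.card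 (χ σ) = n → (∀ a ∈ χ σ, ∃ m : ℤ, a = (m : ℂ) + 1 / 2) → Q.1.HasAsaiSignCont cK 1),
    ∀ (F₀ F : Type) [Field F₀] [NumberField F₀] [Field F] [NumberField F] [Algebra F₀ F]
      (τ : F ≃ₐ[F₀] F) (n : ℕ) (hcpt : isCompact_glFiniteIntegralLevel n F)
      (π : CuspidalAutomorphicRepData n F hcpt) (e : FramedGaloisRep F₀ ℂ 1) (k : ℤ)
      (ℓ : ℕ) [Fact ℓ.Prime] (ι : PadicAlgCl ℓ ≃+* ℂ) (eψ : FramedGaloisRep F ℂ 1),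
      Hyps τ n π e k ℓ eψ → ¬ IsTotallyReal F →
    ∀ (K : Type) [Field K] [NumberField K] [Algebra F₀ K] [IsCMField K],
      Module.finrank F₀ K = 2 →
      (∃ v₀ : HeightOneSpectrum (𝓞 F₀), ¬ Algebra.IsUnramifiedIn (𝓞 K) v₀.asIdeal ∧
        ∃ (α : HeightOneSpectrum (𝓞 F) → Multiset ℂ) (c : HeightOneSpectrum (𝓞 F) → ℂ),
          Guard π eψ v₀ α c) →
      IsEmpty (F →ₐ[F₀] K) → MemberPkgCont F₀ π ι eψ K := by
  intro hAI hBC hext harch hHen hinf hCFT hex hpin hpane F₀ F _ _ _ _ _ τ n hcpt π e k ℓ _ ι eψ hH hF K _ _ _ _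
    h2 hram hemp
  obtain ⟨hTR, hdeg, hτ, -⟩ := id hH
  -- the involution of `K/F₀`
  haveI : Algebra.IsQuadraticExtension F₀ K := ⟨h2⟩
  obtain ⟨cK, hcK⟩ :=
    Literature.NumberTheory.QuadraticForms.QuadraticExtension.exists_algEquiv_ne_one (K := F₀) (E := K)
  -- the pane tower
  obtain ⟨L, F', _, _, _, _, _, _, _, _, _, _, _, s, hT⟩ :=
    stub_memberTower F₀ F τ hTR hdeg hτ K cK h2 hcK hemp
  -- the Artin avatars and the restriction
  obtain ⟨χe, hχefin, hχe⟩ := artinReciprocity_character_holds F₀ e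
  obtain ⟨ω, hfin, hω⟩ := artinReciprocity_character_holds F eψ
  obtain ⟨ω₀, hω₀⟩ := heckeCharacter_exists_restrict F₀ ω
  -- parity, then the sign step over the Satake / arch / pane-arch outputs
  have hpar := stub_memberParity hCFT F₀ F τ n hcpt π e k ℓ eψ hH K h2 χe ω ω₀ hχe hω hω₀
  refine stub_memberSign_cont hex hpin hpane F₀ F τ n hcpt π e k ℓ ι eψ hH hF K cK h2 hcK L F' s hT
    (χe * ω₀) hpar fun μ hμ ↦ ?_
  obtain ⟨ψu, νk, ν, Pind, PiK, τ', P₀, P, hrel, hout⟩ :=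
    stub_memberSatake hAI hBC hext F₀ F τ n hcpt π e k ℓ ι eψ hH K cK h2 hcK hram L F' s hT χe ω hfin
      ω₀ hχe hχefin hω hω₀ μ hμ
  obtain ⟨T, hT'⟩ := stub_memberArch harch hHen hinf F₀ F τ n hcpt π e k ℓ eψ hH K h2 L μ χe ω hfin ω₀
    ψu νk ν Pind PiK τ' P₀ P hrel
  obtain ⟨χ, hχ⟩ := stub_memberPaneArch harch hinf F₀ F τ n hcpt π e k ℓ eψ hH K cK h2 hcK L F' s hT μ
    χe ω hfin ω₀ ψu νk ν Pind PiK τ' P₀ P hrel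
  exact ⟨τ', ψu * νk * ν, P, T, χ, hout, hT', hχ⟩

end Compose

/-! ## The reshaped `stub_package` in continuation form: family assembly ∘ split -/

/-- **The reshaped `stub_package` in the continuation-form currency (CHECKED COMPOSITION over the
split)**: the facts of `pkg_member_of_split_cont`, the crux data with `Hyps` and `F` not totally real;
conclusion = the family output (sign conjunct `HasAsaiSignCont … 1`) consumed by the landed `stub_patch`
through `stub_galoisOverK_cont`.  Proof: `stub_package_of_member_cont` ∘ `pkg_member_of_split_cont`.
[cite: Sorensen2020, §1 Example] [cite: Mok2014, Thm. 2.5.4 (a)] -/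
theorem stub_package_cont : ∀ (hAI : automorphicInduction_cyclic_cuspidal_unramified)
    (hBC : ∀ (n : ℕ) (F E : Type) [Field F] [NumberField F] [Field E] [NumberField E] [Algebra F E]
      [IsGalois F E], (Module.finrank F E).Prime →
      ∀ (hF : isCompact_glFiniteIntegralLevel n F) (π : CuspidalAutomorphicRepData n F hF),
        (∃ v : HeightOneSpectrum (𝓞 F), ¬ Algebra.IsUnramifiedIn (𝓞 E) v.asIdeal ∧ π.1.IsUnramifiedAt v) →
        ∀ (hE : isCompact_glFiniteIntegralLevel n E),
          ∃ P : CuspidalAutomorphicRepData n E hE, IsUnramifiedBaseChangeLift π.1 P.1)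
    (hext : ∀ (F₀ K : Type) [Field F₀] [NumberField F₀] [Field K] [NumberField K] [Algebra F₀ K]
      (c : K ≃ₐ[F₀] K), Module.finrank F₀ K = 2 → c ≠ 1 →
      ∀ (χ₀ : HeckeCharacter F₀), χ₀.IsUnitary →
      ∀ (U : Set (HeightOneSpectrum (𝓞 K))),
        (∀ u ∈ U, c • u ∈ U → χ₀.IsUnramifiedAt (u.under (𝓞 F₀))) →
        ∃ χ : HeckeCharacter K, χ.IsUnitary ∧
          (∀ x, χ (AdeleRing.ideleBaseChange F₀ K x) = χ₀ x) ∧ ∀ u ∈ U, χ.IsUnramifiedAt u)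
    (harch : ArthurClozel1989_strongLifting_archimedean)
    (hHen : Henniart2012_infinityType_of_automorphicInduction)
    (hinf : ∀ (N : ℕ) (K : Type) [Field K] [NumberField K] (hK : isCompact_glFiniteIntegralLevel N K)
      (P : AutomorphicRepData (AutomorphyDatum.gl N K hK)), P.exists_hasInfinityType)
    (hCFT : artinReciprocity_character_archimedean)
    (hex : ∀ (F E : Type) [Field F] [NumberField F] [Field E] [NumberField E] [Algebra F E] (c : E ≃ₐ[F] E), Module.finrank F E = 2 → c ≠ 1 → ∀ (N : ℕ) (hcpt : isCompact_glFiniteIntegralLevel N E) (P : CuspidalAutomorphicRepData N E hcpt), 0 < N → P.1.IsConjSelfDualAE c → ∃ κ : ℤˣ, P.1.HasAsaiSignCont c κ)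
    (hpin : ∀ (F E : Type) [Field F] [NumberField F] [Field E] [NumberField E] [Algebra F E] (c : E ≃ₐ[F] E), Module.finrank F E = 2 → c ≠ 1 → ∀ (N : ℕ) (hcpt : isCompact_glFiniteIntegralLevel N E) (P : CuspidalAutomorphicRepData N E hcpt) (κ : ℤˣ) (χ : (E →+* ℂ) → Multiset ℂ) (σ : E →+* ℂ) (r : ℝ), 0 < N → P.1.IsConjSelfDualAE c → P.1.HasAsaiSignCont c κ → P.1.HasArchParameter χ → NumberField.ComplexEmbedding.IsConj σ c → (χ σ).Nodup → (∀ a ∈ χ σ, ∃ m : ℤ, a = (m : ℂ) + (r : ℂ)) → ∀ a ∈ χ σ, ∃ m : ℤ, a = (m : ℂ) + ((N : ℂ) - 1) / 2 + (1 - ((κ : ℤ) : ℂ)) / 4)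
    (hpane : ∀ (F₀ K F' L : Type) [Field F₀] [NumberField F₀] [Field K] [NumberField K] [Field F'] [NumberField F'] [Field L] [NumberField L] [Algebra F₀ K] [Algebra K L] [Algebra F' L] (cK : K ≃ₐ[F₀] K) (s : L ≃ₐ[F'] L), Module.finrank F₀ K = 2 → Module.finrank K L = 2 → Module.finrank F' L = 2 → cK ≠ 1 → s ≠ 1 → (∀ x : K, s (algebraMap K L x) = algebraMap K L (cK x)) → ∀ (n : ℕ) (hL : isCompact_glFiniteIntegralLevel n L) (hK : isCompact_glFiniteIntegralLevel (2 * n) K) (P : CuspidalAutomorphicRepData n L hL) (Q : CuspidalAutomorphicRepData (2 * n) K hK) (χ : (L →+* ℂ) → Multiset ℂ) (σ : L →+* ℂ), 0 < n → IsAutomorphicInductionAlong P.1 Q.1 → P.1.IsConjSelfDualAE s → Q.1.IsConjSelfDualAE cK → P.1.HasArchParameter χ → NumberField.ComplexEmbedding.IsConj σ s → (χ σ).Nodup → Multiset.card (χ σ) = n → (∀ a ∈ χ σ, ∃ m : ℤ, a = (m : ℂ) + 1 / 2) → Q.1.HasAsaiSignCont cK 1),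
    ∀ (F₀ F : Type) [Field F₀] [NumberField F₀] [Field F] [NumberField F] [Algebra F₀ F]
      (τ : F ≃ₐ[F₀] F) (n : ℕ) (hcpt : isCompact_glFiniteIntegralLevel n F)
      (π : CuspidalAutomorphicRepData n F hcpt) (e : FramedGaloisRep F₀ ℂ 1) (k : ℤ)
      (ℓ : ℕ) [Fact ℓ.Prime] (ι : PadicAlgCl ℓ ≃+* ℂ) (eψ : FramedGaloisRep F ℂ 1),
      Hyps τ n π e k ℓ eψ → ¬ IsTotallyReal F →
    ∃ (m : ℕ) (B : Set ℕ), m ≠ 0 ∧ B.Finite ∧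
    ∃ (hK : ∀ D : QuadraticFamily.GoodPrime F₀ m B,
        isCompact_glFiniteIntegralLevel (2 * n) (QuadraticFamily.sqrtNegField F₀ D.1))
      (τ' : ∀ D : QuadraticFamily.GoodPrime F₀ m B,
        CuspidalAutomorphicRepData (2 * n) (QuadraticFamily.sqrtNegField F₀ D.1) (hK D))
      (T : ∀ D : QuadraticFamily.GoodPrime F₀ m B,
        InfinityType (QuadraticFamily.sqrtNegField F₀ D.1) (2 * n))
      (ψ₁ : ∀ D : QuadraticFamily.GoodPrime F₀ m B,
        HeckeCharacter (QuadraticFamily.sqrtNegField F₀ D.1)),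
      (∀ (D : QuadraticFamily.GoodPrime F₀ m B) [IsCMField (QuadraticFamily.sqrtNegField F₀ D.1)],
          (τ' D).1.HasInfinityType (T D) ∧ (T D).IsCAlgebraic ∧ (T D).IsWeaklyRegular ∧
          (τ' D).1.IsConjSelfDualAE
            (NumberField.IsCMField.complexConj (QuadraticFamily.sqrtNegField F₀ D.1)) ∧
          (τ' D).1.HasAsaiSignCont
            (NumberField.IsCMField.complexConj (QuadraticFamily.sqrtNegField F₀ D.1)) 1 ∧
          (ψ₁ D).IsAlgebraic) ∧
      (∀ D : QuadraticFamily.GoodPrime F₀ m B,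
        ∀ᶠ u : HeightOneSpectrum (𝓞 (QuadraticFamily.sqrtNegField F₀ D.1)) in Filter.cofinite,
        ∀ (v : HeightOneSpectrum (𝓞 F₀)) (α : HeightOneSpectrum (𝓞 F) → Multiset ℂ)
          (c : HeightOneSpectrum (𝓞 F) → ℂ), u.under (𝓞 F₀) = v → ((ℓ : ℕ) : 𝓞 F₀) ∉ v.asIdeal →
        (∀ w : HeightOneSpectrum (𝓞 F), w.under (𝓞 F₀) = v → w.asIdeal.ramificationIdx (𝓞 F₀) = 1 ∧
            π.1.HasSatakeParamAt w (α w) ∧ eψ.IsUnramifiedAt w ∧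
            eψ.HasFrobCharpolyAt w (Polynomial.X - Polynomial.C (c w))) →
        ((ℓ : ℕ) : 𝓞 (QuadraticFamily.sqrtNegField F₀ D.1)) ∉ u.asIdeal ∧ (ψ₁ D).IsUnramifiedAt u ∧
        ∃ β : Multiset ℂ, (τ' D).1.HasSatakeParamAt u β ∧
          arithFrobPolyOfSatake ι u.residueCard (2 * n)
              (β.map (fun b ↦ b * ((ψ₁ D).valueAtUniformizer u)⁻¹)) =
            (((∏ᶠ w ∈ {w : HeightOneSpectrum (𝓞 F) | w.under (𝓞 F₀) = v},
              Polynomial.expand (PadicAlgCl ℓ) (w.asIdeal.inertiaDeg (𝓞 F₀))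
                (arithFrobPolyOfSatake ι w.residueCard n ((α w).map (fun a ↦ a * c w)))).roots.map
            (fun x ↦ Polynomial.X - Polynomial.C (x ^ u.asIdeal.inertiaDeg (𝓞 F₀)))).prod)) ∧
      (∀ (v : HeightOneSpectrum (𝓞 F₀)) (α : HeightOneSpectrum (𝓞 F) → Multiset ℂ)
          (c : HeightOneSpectrum (𝓞 F) → ℂ), ((ℓ : ℕ) : 𝓞 F₀) ∉ v.asIdeal →
        (∀ w : HeightOneSpectrum (𝓞 F), w.under (𝓞 F₀) = v → w.asIdeal.ramificationIdx (𝓞 F₀) = 1 ∧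
            π.1.HasSatakeParamAt w (α w) ∧ eψ.IsUnramifiedAt w ∧
            eψ.HasFrobCharpolyAt w (Polynomial.X - Polynomial.C (c w))) →
        ∃ D : QuadraticFamily.GoodPrime F₀ m B,
          (v.asIdeal.primesOver (𝓞 (QuadraticFamily.sqrtNegField F₀ D.1))).ncard = 2 ∧
          ∃ u : HeightOneSpectrum (𝓞 (QuadraticFamily.sqrtNegField F₀ D.1)), u.under (𝓞 F₀) = v ∧
            ((ℓ : ℕ) : 𝓞 (QuadraticFamily.sqrtNegField F₀ D.1)) ∉ u.asIdeal ∧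
            (ψ₁ D).IsUnramifiedAt u ∧
            ∃ β : Multiset ℂ, (τ' D).1.HasSatakeParamAt u β ∧
              arithFrobPolyOfSatake ι u.residueCard (2 * n)
                  (β.map (fun b ↦ b * ((ψ₁ D).valueAtUniformizer u)⁻¹)) =
                (∏ᶠ w ∈ {w : HeightOneSpectrum (𝓞 F) | w.under (𝓞 F₀) = v},
                  Polynomial.expand (PadicAlgCl ℓ) (w.asIdeal.inertiaDeg (𝓞 F₀))
                    (arithFrobPolyOfSatake ι w.residueCard n ((α w).map (fun a ↦ a * c w))))) := by
  intro hAI hBC hext harch hHen hinf hCFT hex hpin hpane F₀ F _ _ _ _ _ τ n hcpt π e k ℓ _ ι eψ hH hF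
  exact stub_package_of_member_cont F₀ F hH.1 hH.2.1 n hcpt π ℓ ι eψ fun K _ _ _ _ h2 hram hemp ↦
    pkg_member_of_split_cont hAI hBC hext harch hHen hinf hCFT hex hpin hpane F₀ F τ n hcpt π e k ℓ ι eψ
      hH hF K h2 hram hemp

end Summit.Langlands.Langlands.Theorems.HostInducedRep.OneTransparentPane

end
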